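import Summits.BirchSwinnertonDyer.BirchSwinnertonDyer.Theorems.PrintX10bHowardContainmentPinnedOfThreeLeaves
import HarnessLib

/-!
# T-KS10 — closer of the closes⁶ A-side glue item `PrintX10b.HowardContainmentLightFrameX10bPinnedOfKSLeaves`

One line over the three-leaf theorem p696595.  Land with
`ledger propose --kind proof --target Summits/BirchSwinnertonDyer/BirchSwinnertonDyer/Theorems/PrintX10bHowardContainmentPinnedOfKSLeavesEntry.lean
 --file PrintX10bKSLeavesEntry.lean --workitem <id of HowardContainmentLightFrameX10bPinnedOfKSLeaves>` AFTER the pen's «PrintX10b REWRITTEN»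
line.  GLUE only; the three print leaves stay hypotheses of `closes`.  BSD is not proved by this.
[cite: Howard2004HeegnerKolyvagin, Thm. 1.6.1] [cite: CastellaGrossiLeeSkinner2022, Thm. 4.1.1] [cite: CastellaGrossiSkinner2025, Thm. 6.5.2]
-/

set_option linter.dupNamespace false

namespace Summit.BirchSwinnertonDyer.BirchSwinnertonDyer.Theorems.PrintX10bKSLeavesEntry

open Summit.BirchSwinnertonDyer.BirchSwinnertonDyer.Theses.PrintX10b

/-- `HowardContainmentLightFrameX10bPinnedOfKSLeaves` holds (p696595). [cite: Howard2004HeegnerKolyvagin, Thm. 1.6.1]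
[cite: CastellaGrossiLeeSkinner2022, Thm. 4.1.1] [cite: CastellaGrossiSkinner2025, Thm. 6.5.2] -/
theorem howardContainmentLightFrameX10bPinnedOfKSLeaves_holds : HowardContainmentLightFrameX10bPinnedOfKSLeaves :=
  fun hH hK hCGS =>
    PrintX10bOfKSLeaf.howardContainmentLightFrameX10bPinned_of_howard_kolyvaginSystem_cgs hH hK hCGS

end Summit.BirchSwinnertonDyer.BirchSwinnertonDyer.Theorems.PrintX10bKSLeavesEntry
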